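import Summits.HubbardSuperconductivity.HubbardSuperconductivity.Theorems.KLProgrammeKLRegimeScaleZeroRecordPairRaw
import Summits.HubbardSuperconductivity.HubbardSuperconductivity.Theorems.KLProgrammeKLRegimeScaleZeroRecordPairTables

/-!
# Route `KLProgramme`, crux K3 — ENGINE (stmt-HubbardSuperconductivity-20437), row (C) `stub_twoLeg_curvature`, the SCALE-0 PRIVATE PAIR of `hres′` FROM THE RECORD ROWS,
# part 3/3: the PRIVATE pair, the REGISTERED pair, and the (C) closer's prefix form

Seat hubbard-kl-k3c5-p1 (g20; lineage owner of #22a).  Composition of part 1 (`twoLegRead_frameZero_raw_of_records`) with part 2 (`scaleZeroRawTables_le`):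
* **`twoLegRead_frameZero_private_of_records`** — on `μ ∈ klWindowC`, `0 < U ≤ klTailBookU`, `klBetaMin ≤ β`, `klEngL₃ β U ≤ L`, `klEngM₃ β U L ≤ M`, from the
  #22a rows `hS12` (k = 1, 2), the #22b rows `hSjet` (k = 3, 4) and the free Fermi-point sizes `hD`:
  `TwoLegReadJetBound L M cP cP′ β U μ (K₀) 0 ∧ TwoLegReadOscAt L M 2⁵³ β U μ (K₀) 0`, `cP = (5, bS₁D₁ + δ, bS₂D₁² + bS₁D₂ + δ, sS₃ + δ, sS₄ + δ, 0, …)`, `cP′ = (2⁵², 0, …)`;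
* **`twoLegRead_frameZero_registered_of_records`** — plus the four numeric fits `bS₁D₁ + δ ≤ 2¹⁰`, `bS₂D₁² + bS₁D₂ + δ ≤ 2⁴`, `sS₃ + δ ≤ 2⁴`, `sS₄ + δ ≤ 2¹¹` ⟹
  `TwoLegReadJetBound L M klC4aJetC2 (klC4aJetC′ P R) β U μ (K₀) 0 ∧ TwoLegReadOscAt L M (klReadOscC P R) β U μ (K₀) 0` (`2⁵² ≤ klC4aJetC′ P R 0 = 2⁸⁰Psq²Rsq²`);
* **`twoLegRead_frameZero_registered_klEngGQ_of_records`** — the same under the (C) closer's literal prefix (`c ≤ klEngC₃7GU G P R`, `U ≤ klEngU₀12GQ G Q P R c`,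
  `klEngL₄ P R β U ≤ L`, …; `klEngU₀12GQ ≤ klTailBookU`, `klEngL₃ ≤ klEngL₄`) from ONE pointwise record hypothesis `hrec`.
⟹ the scale-`0` member of `hres′` (…ClosersCGQGuardInst l.197–200, at `cc := klC4aJetC2`, `cc′ := klC4aJetC′ P R`, `x₀ := klReadOscC P R`) has as residual EXACTLY
{#22a rows k = 1, 2; #22b rows k = 3, 4; the curve sizes `D₁…D₄`; four numeric fits} — every other input is a tree theorem.
Proofs only; no definitions; nothing here asserts (C), any stub of 20437, K3 or superconductivity; the record rows are HYPOTHESES (kit records, FROZEN).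
References: BGM 2006 §2.3–§2.4 Lemma 2.1 (2.36)–(2.42), §3 (3.2)–(3.3) [cite: BenfattoGiulianiMastropietro2006].
-/

noncomputable section

namespace Summit.HubbardSuperconductivity.HubbardSuperconductivity.Theorems.KLRegimeSplit

set_option linter.dupNamespace false -- summit = problem name (single-conjunct summit), D-0017
set_option exponentiation.threshold 4096 -- `klTailBookU = 10⁻³⁰⁰` bookkeeping

open Real Finset Complex Literature.MathematicalPhysics.QuantumLattice Literature.Probability.LatticeModels GrassmannAlgebra Matrix
open Literature.MathematicalPhysics.QuantumLattice.FermiRG Literature.Probability.LatticeModels.BattleFederbush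
open Summit.HubbardSuperconductivity.HubbardSuperconductivity.Theorems.KLProgrammeLegKernels
open Summit.HubbardSuperconductivity.HubbardSuperconductivity.Theorems.TwoLegFourier
open Summit.HubbardSuperconductivity.HubbardSuperconductivity.Theorems.EngineV8
open Summit.HubbardSuperconductivity.HubbardSuperconductivity.Theorems.PerturbedFermiCurve
open Summit.HubbardSuperconductivity.HubbardSuperconductivity.Theorems.DispersionFlow
open Summit.HubbardSuperconductivity.HubbardSuperconductivity.Theorems.C4a (bell4)
open scoped Nat

/-! ## §1 The private scale-`0` pair from the record rows -/

section PrivatePair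

variable {L M : ℕ} [NeZero L] [NeZero M] {μ U β : ℝ}

/-- **THE SCALE-0 PRIVATE PAIR OF `hres′` FROM THE RECORD ROWS**: on `μ ∈ klWindowC`, `0 < U ≤ klTailBookU`, `klBetaMin ≤ β`, `klEngL₃ β U ≤ L`, `klEngM₃ β U L ≤ M`,
from the CERTIFIED Euclidean sunset moments `hS12` (k = 1, 2; #22a), the sunset's on-curve jets `hSjet` (k = 3, 4; #22b) and the free Fermi-point sizes `hD`:
`TwoLegReadJetBound L M cP cP′ β U μ (K₀) 0 ∧ TwoLegReadOscAt L M 2⁵³ β U μ (K₀) 0` with `cP = (5, bS₁D₁ + δ, bS₂D₁² + bS₁D₂ + δ, sS₃ + δ, sS₄ + δ, 0, …)`, `cP′ = (2⁵², 0, …)`,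
`δ = (1 + D₁ + D₂ + D₃ + D₄)⁴/10⁷⁸` — every other input of `twoLegRead_frameZero_of_sunsetData` is a tree theorem. [cite: BenfattoGiulianiMastropietro2006, §2.4 (2.36)-(2.42)] -/
theorem twoLegRead_frameZero_private_of_records (hβ : klBetaMin ≤ β) (hμ : μ ∈ klWindowC) (hU : 0 < U) (hUb : U ≤ klTailBookU)
    (hL : klEngL₃ β U ≤ L) (hM : klEngM₃ β U L ≤ M) {bS sS D : ℕ → ℝ}
    (hS12 : ∀ k, 1 ≤ k → k ≤ 2 → ∀ (σ : Fin 2) (p₀ : GridPoint L (2 * (2 * M))), ∑ p₁ : GridPoint L (2 * (2 * M)),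
      (if p₁ = p₀ then (0 : ℝ) else
        Real.sqrt ((((p₁.2 - p₀.2) 0).valMinAbs.natAbs : ℝ) ^ 2 + (((p₁.2 - p₀.2) 1).valMinAbs.natAbs : ℝ) ^ 2) ^ k * ‖contr ℂ ((hubbardGridSub L M β (2 * (2 * M))).transpose * hubbardCovAboveCT L M β μ 0 0 klE0 *
                hubbardGridSub L M β (2 * (2 * M))) (((p₁, σ), 0) : GridLeg (GridPoint L (2 * (2 * M)))) ((p₀, σ), 1) *
              (contr ℂ ((hubbardGridSub L M β (2 * (2 * M))).transpose * hubbardCovAboveCT L M β μ 0 0 klE0 *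
                hubbardGridSub L M β (2 * (2 * M))) (((p₀, σ.rev), 0) : GridLeg (GridPoint L (2 * (2 * M)))) ((p₁, σ.rev), 1) *
                contr ℂ ((hubbardGridSub L M β (2 * (2 * M))).transpose * hubbardCovAboveCT L M β μ 0 0 klE0 *
                hubbardGridSub L M β (2 * (2 * M))) (((p₁, σ.rev), 0) : GridLeg (GridPoint L (2 * (2 * M)))) ((p₀, σ.rev), 1))‖) ≤
        bS k * (((2 * (2 * M) : ℕ) : ℝ) / β))
    (hSjet : ∀ k, 3 ≤ k → k ≤ 4 → ∀ θ : ℝ, |iteratedDeriv k (fun θ : ℝ => evalM (symInterp L (fun pp : TorusSite 2 L =>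
        (∑ σσ : Fin 2, ((selfEnergy L M β (ExteriorAlgebra.map (Matrix.toLin' (gridSubMatrix L M β
            (fun p : GridPoint L (2 * (2 * M)) => p.2) (fun p => gridTime β (2 * (2 * M)) p.1)))
          (∑ p' : GridPoint L (2 * (2 * M)), ∑ q' : GridPoint L (2 * (2 * M)), ∑ σ' : Fin 2,
          (if p' = q' then (0 : ℂ) else
            -((((U * (β / (2 * (2 * M) : ℕ)) : ℝ) : ℂ) ^ 2 *
              (contr ℂ ((hubbardGridSub L M β (2 * (2 * M))).transpose * hubbardCovAboveCT L M β μ 0 0 klE0 *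
                  hubbardGridSub L M β (2 * (2 * M))) (((q', σ'), 0) : GridLeg (GridPoint L (2 * (2 * M)))) ((p', σ'), 1) *
                (contr ℂ ((hubbardGridSub L M β (2 * (2 * M))).transpose * hubbardCovAboveCT L M β μ 0 0 klE0 *
                    hubbardGridSub L M β (2 * (2 * M))) (((p', σ'.rev), 0) : GridLeg (GridPoint L (2 * (2 * M)))) ((q', σ'.rev), 1) *
                  contr ℂ ((hubbardGridSub L M β (2 * (2 * M))).transpose * hubbardCovAboveCT L M β μ 0 0 klE0 *
                    hubbardGridSub L M β (2 * (2 * M))) (((q', σ'.rev), 0) : GridLeg (GridPoint L (2 * (2 * M)))) ((p', σ'.rev), 1)))))) •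
            (gen ℂ (((p', σ'), 0) : GridLeg (GridPoint L (2 * (2 * M)))) * gen ℂ (((q', σ'), 1) : GridLeg (GridPoint L (2 * (2 * M))))))) (omega0 M, pp) σσ).re +
        (selfEnergy L M β (ExteriorAlgebra.map (Matrix.toLin' (gridSubMatrix L M β
            (fun p : GridPoint L (2 * (2 * M)) => p.2) (fun p => gridTime β (2 * (2 * M)) p.1)))
          (∑ p' : GridPoint L (2 * (2 * M)), ∑ q' : GridPoint L (2 * (2 * M)), ∑ σ' : Fin 2,
          (if p' = q' then (0 : ℂ) else
            -((((U * (β / (2 * (2 * M) : ℕ)) : ℝ) : ℂ) ^ 2 *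
              (contr ℂ ((hubbardGridSub L M β (2 * (2 * M))).transpose * hubbardCovAboveCT L M β μ 0 0 klE0 *
                  hubbardGridSub L M β (2 * (2 * M))) (((q', σ'), 0) : GridLeg (GridPoint L (2 * (2 * M)))) ((p', σ'), 1) *
                (contr ℂ ((hubbardGridSub L M β (2 * (2 * M))).transpose * hubbardCovAboveCT L M β μ 0 0 klE0 *
                    hubbardGridSub L M β (2 * (2 * M))) (((p', σ'.rev), 0) : GridLeg (GridPoint L (2 * (2 * M)))) ((q', σ'.rev), 1) *
                  contr ℂ ((hubbardGridSub L M β (2 * (2 * M))).transpose * hubbardCovAboveCT L M β μ 0 0 klE0 *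
                    hubbardGridSub L M β (2 * (2 * M))) (((q', σ'.rev), 0) : GridLeg (GridPoint L (2 * (2 * M)))) ((p', σ'.rev), 1)))))) •
            (gen ℂ (((p', σ'), 0) : GridLeg (GridPoint L (2 * (2 * M)))) * gen ℂ (((q', σ'), 1) : GridLeg (GridPoint L (2 * (2 * M))))))) ((omega0 M).rev, pp) σσ).re)) / 4))
        (WithLp.toLp 2 (klFermiPoint μ 0 θ))) θ| ≤ sS k * U ^ 2)
    (hD : ∀ θ : ℝ, ∀ i, 1 ≤ i → i ≤ 4 → ‖iteratedDeriv i (fun θ : ℝ => (WithLp.toLp 2 (klFermiPoint μ 0 θ) : Momentum)) θ‖ ≤ D i) :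
    TwoLegReadJetBound L M
        (fun k => if k = 0 then 5 else if k = 1 then bS 1 * D 1 + (1 + D 1 + D 2 + D 3 + D 4) ^ 4 / (10 : ℝ) ^ 78
          else if k = 2 then bS 2 * D 1 ^ 2 + bS 1 * D 2 + (1 + D 1 + D 2 + D 3 + D 4) ^ 4 / (10 : ℝ) ^ 78
          else if k = 3 then sS 3 + (1 + D 1 + D 2 + D 3 + D 4) ^ 4 / (10 : ℝ) ^ 78
          else if k = 4 then sS 4 + (1 + D 1 + D 2 + D 3 + D 4) ^ 4 / (10 : ℝ) ^ 78 else 0)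
        (fun k => if k = 0 then (2 : ℝ) ^ 52 else 0) β U μ (klFlowFrameU L M β U μ 0) 0 ∧
      TwoLegReadOscAt L M ((2 : ℝ) ^ 53) β U μ (klFlowFrameU L M β U μ 0) 0 := by
  obtain ⟨-, -, hM2, hβM, -, -⟩ := scaleZero_regime_sizes (U := U) hβ hL hM
  have hβ0 : 0 < β := lt_of_lt_of_le (by norm_num [klBetaMin]) hβ
  have hN : (0 : ℝ) < ((2 * (2 * M) : ℕ) : ℝ) := by have := NeZero.ne M; positivity
  obtain ⟨hJ, hO⟩ := twoLegRead_frameZero_raw_of_records (L := L) (M := M) hβ hμ hU hUb hL hM hS12 hSjet hD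
  have hε1 : β / ((2 * (2 * M) : ℕ) : ℝ) ≤ 1 := by
    rw [div_le_one hN]
    have hM' : (M : ℝ) ≤ ((2 * (2 * M) : ℕ) : ℝ) := by push_cast; linarith [show (0:ℝ) ≤ M from Nat.cast_nonneg M]
    linarith
  have hc0 : 16 * 16 * klScaleZeroA0 ≤ (2 : ℝ) ^ 51 := by
    calc 16 * 16 * klScaleZeroA0 ≤ 16 * 16 * (2 : ℝ) ^ 43 := by gcongr; exact klScaleZeroA0_le_two_pow
      _ = (2 : ℝ) ^ 51 := by norm_num
  have hS0 : (0 : ℝ) ≤ (2 : ℝ) ^ 13 * Real.exp 1 ^ 27 * (46 : ℝ) ^ 3 * ((10 : ℝ) ^ 95) ^ 2 :=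
    mul_nonneg (mul_nonneg (mul_nonneg (pow_nonneg zero_le_two 13) (pow_nonneg (Real.exp_pos 1).le 27)) (pow_nonneg (by norm_num) 3))
      (pow_nonneg (pow_nonneg (by norm_num) 95) 2)
  obtain ⟨h1, h2, h3⟩ := scaleZeroRawTables_le (bS := bS) (sS := sS) (D := D) hS0 klTailBookU_pos.le
    (fun k hk => by simpa only [mul_assoc] using scaleZero_tailConst_le k hk) scaleZero_tailConstOn_le (scaleZero_aliasConst_le hU hUb) hc0 hε1
    (fun i hi1 hi4 => (norm_nonneg _).trans (hD 0 i hi1 hi4))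
  exact ⟨hJ.mono h1 h2, hO.mono h3⟩

end PrivatePair

/-! ## §2 The REGISTERED scale-`0` pair and the (C) closer's prefix -/

section Registered

variable {L M : ℕ} [NeZero L] [NeZero M] {μ U β : ℝ}

/-- `2⁵³ ≤ klReadOscC P R` and `2⁵² ≤ klC4aJetC′ P R 0` (`klC4aJetC′ P R 0 = 2²⁰·2⁶⁰·Psq²·Rsq²`, `Psq, Rsq ≥ 1`). -/
theorem two_pow_le_klC4aJetC'_zero (P : SplitConsts) (R : RenConsts) :
    (2 : ℝ) ^ 52 ≤ klC4aJetC' P R 0 ∧ (2 : ℝ) ^ 53 ≤ klReadOscC P R := by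
  have hP := one_le_klEngPsq P
  have hR := one_le_klEngRsq R
  have h1 : (1 : ℝ) ≤ klEngPsq P ^ 2 * klEngRsq R ^ 2 := by
    have h2 : (1 : ℝ) ≤ klEngPsq P ^ 2 := one_le_pow₀ hP
    have h3 : (1 : ℝ) ≤ klEngRsq R ^ 2 := one_le_pow₀ hR
    nlinarith
  have hC : (2 : ℝ) ^ 52 ≤ klC4aJetC' P R 0 := by
    rw [klC4aJetC'_eq, show (klEngQ5 P R).S' 0 = 2 ^ 60 * klEngPsq P ^ 2 * klEngRsq R ^ 2 from rfl]
    nlinarith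
  refine ⟨hC, ?_⟩
  rw [klReadOscC_eq_two_mul]
  linarith

/-- **THE REGISTERED SCALE-0 PAIR FROM THE RECORD ROWS AND FOUR NUMERIC FITS**: on `μ ∈ klWindowC`, `0 < U ≤ klTailBookU`, `klBetaMin ≤ β`, `klEngL₃ β U ≤ L`,
`klEngM₃ β U L ≤ M`, from `hS12` (#22a), `hSjet` (#22b), `hD` (free Fermi-point sizes) and the fits `bS₁D₁ + δ ≤ 2¹⁰`, `bS₂D₁² + bS₁D₂ + δ ≤ 2⁴`, `sS₃ + δ ≤ 2⁴`,
`sS₄ + δ ≤ 2¹¹` (`δ = (1 + D₁ + D₂ + D₃ + D₄)⁴/10⁷⁸`):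
`TwoLegReadJetBound L M klC4aJetC2 (klC4aJetC′ P R) β U μ (K₀) 0 ∧ TwoLegReadOscAt L M (klReadOscC P R) β U μ (K₀) 0` — the `n = 0` member of row (C).
[cite: BenfattoGiulianiMastropietro2006, §2.4 Lemma 2.1 (2.36)-(2.42)] -/
theorem twoLegRead_frameZero_registered_of_records (P : SplitConsts) (R : RenConsts) (hβ : klBetaMin ≤ β) (hμ : μ ∈ klWindowC) (hU : 0 < U)
    (hUb : U ≤ klTailBookU) (hL : klEngL₃ β U ≤ L) (hM : klEngM₃ β U L ≤ M) {bS sS D : ℕ → ℝ}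
    (hS12 : ∀ k, 1 ≤ k → k ≤ 2 → ∀ (σ : Fin 2) (p₀ : GridPoint L (2 * (2 * M))), ∑ p₁ : GridPoint L (2 * (2 * M)),
      (if p₁ = p₀ then (0 : ℝ) else
        Real.sqrt ((((p₁.2 - p₀.2) 0).valMinAbs.natAbs : ℝ) ^ 2 + (((p₁.2 - p₀.2) 1).valMinAbs.natAbs : ℝ) ^ 2) ^ k * ‖contr ℂ ((hubbardGridSub L M β (2 * (2 * M))).transpose * hubbardCovAboveCT L M β μ 0 0 klE0 *
                hubbardGridSub L M β (2 * (2 * M))) (((p₁, σ), 0) : GridLeg (GridPoint L (2 * (2 * M)))) ((p₀, σ), 1) *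
              (contr ℂ ((hubbardGridSub L M β (2 * (2 * M))).transpose * hubbardCovAboveCT L M β μ 0 0 klE0 *
                hubbardGridSub L M β (2 * (2 * M))) (((p₀, σ.rev), 0) : GridLeg (GridPoint L (2 * (2 * M)))) ((p₁, σ.rev), 1) *
                contr ℂ ((hubbardGridSub L M β (2 * (2 * M))).transpose * hubbardCovAboveCT L M β μ 0 0 klE0 *
                hubbardGridSub L M β (2 * (2 * M))) (((p₁, σ.rev), 0) : GridLeg (GridPoint L (2 * (2 * M)))) ((p₀, σ.rev), 1))‖) ≤
        bS k * (((2 * (2 * M) : ℕ) : ℝ) / β))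
    (hSjet : ∀ k, 3 ≤ k → k ≤ 4 → ∀ θ : ℝ, |iteratedDeriv k (fun θ : ℝ => evalM (symInterp L (fun pp : TorusSite 2 L =>
        (∑ σσ : Fin 2, ((selfEnergy L M β (ExteriorAlgebra.map (Matrix.toLin' (gridSubMatrix L M β
            (fun p : GridPoint L (2 * (2 * M)) => p.2) (fun p => gridTime β (2 * (2 * M)) p.1)))
          (∑ p' : GridPoint L (2 * (2 * M)), ∑ q' : GridPoint L (2 * (2 * M)), ∑ σ' : Fin 2,
          (if p' = q' then (0 : ℂ) else
            -((((U * (β / (2 * (2 * M) : ℕ)) : ℝ) : ℂ) ^ 2 *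
              (contr ℂ ((hubbardGridSub L M β (2 * (2 * M))).transpose * hubbardCovAboveCT L M β μ 0 0 klE0 *
                  hubbardGridSub L M β (2 * (2 * M))) (((q', σ'), 0) : GridLeg (GridPoint L (2 * (2 * M)))) ((p', σ'), 1) *
                (contr ℂ ((hubbardGridSub L M β (2 * (2 * M))).transpose * hubbardCovAboveCT L M β μ 0 0 klE0 *
                    hubbardGridSub L M β (2 * (2 * M))) (((p', σ'.rev), 0) : GridLeg (GridPoint L (2 * (2 * M)))) ((q', σ'.rev), 1) *
                  contr ℂ ((hubbardGridSub L M β (2 * (2 * M))).transpose * hubbardCovAboveCT L M β μ 0 0 klE0 *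
                    hubbardGridSub L M β (2 * (2 * M))) (((q', σ'.rev), 0) : GridLeg (GridPoint L (2 * (2 * M)))) ((p', σ'.rev), 1)))))) •
            (gen ℂ (((p', σ'), 0) : GridLeg (GridPoint L (2 * (2 * M)))) * gen ℂ (((q', σ'), 1) : GridLeg (GridPoint L (2 * (2 * M))))))) (omega0 M, pp) σσ).re +
        (selfEnergy L M β (ExteriorAlgebra.map (Matrix.toLin' (gridSubMatrix L M β
            (fun p : GridPoint L (2 * (2 * M)) => p.2) (fun p => gridTime β (2 * (2 * M)) p.1)))
          (∑ p' : GridPoint L (2 * (2 * M)), ∑ q' : GridPoint L (2 * (2 * M)), ∑ σ' : Fin 2,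
          (if p' = q' then (0 : ℂ) else
            -((((U * (β / (2 * (2 * M) : ℕ)) : ℝ) : ℂ) ^ 2 *
              (contr ℂ ((hubbardGridSub L M β (2 * (2 * M))).transpose * hubbardCovAboveCT L M β μ 0 0 klE0 *
                  hubbardGridSub L M β (2 * (2 * M))) (((q', σ'), 0) : GridLeg (GridPoint L (2 * (2 * M)))) ((p', σ'), 1) *
                (contr ℂ ((hubbardGridSub L M β (2 * (2 * M))).transpose * hubbardCovAboveCT L M β μ 0 0 klE0 *
                    hubbardGridSub L M β (2 * (2 * M))) (((p', σ'.rev), 0) : GridLeg (GridPoint L (2 * (2 * M)))) ((q', σ'.rev), 1) *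
                  contr ℂ ((hubbardGridSub L M β (2 * (2 * M))).transpose * hubbardCovAboveCT L M β μ 0 0 klE0 *
                    hubbardGridSub L M β (2 * (2 * M))) (((q', σ'.rev), 0) : GridLeg (GridPoint L (2 * (2 * M)))) ((p', σ'.rev), 1)))))) •
            (gen ℂ (((p', σ'), 0) : GridLeg (GridPoint L (2 * (2 * M)))) * gen ℂ (((q', σ'), 1) : GridLeg (GridPoint L (2 * (2 * M))))))) ((omega0 M).rev, pp) σσ).re)) / 4))
        (WithLp.toLp 2 (klFermiPoint μ 0 θ))) θ| ≤ sS k * U ^ 2)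
    (hD : ∀ θ : ℝ, ∀ i, 1 ≤ i → i ≤ 4 → ‖iteratedDeriv i (fun θ : ℝ => (WithLp.toLp 2 (klFermiPoint μ 0 θ) : Momentum)) θ‖ ≤ D i)
    (hfit : bS 1 * D 1 + (1 + D 1 + D 2 + D 3 + D 4) ^ 4 / (10 : ℝ) ^ 78 ≤ (2 : ℝ) ^ 10 ∧
        bS 2 * D 1 ^ 2 + bS 1 * D 2 + (1 + D 1 + D 2 + D 3 + D 4) ^ 4 / (10 : ℝ) ^ 78 ≤ (2 : ℝ) ^ 4 ∧
        sS 3 + (1 + D 1 + D 2 + D 3 + D 4) ^ 4 / (10 : ℝ) ^ 78 ≤ (2 : ℝ) ^ 4 ∧ sS 4 + (1 + D 1 + D 2 + D 3 + D 4) ^ 4 / (10 : ℝ) ^ 78 ≤ (2 : ℝ) ^ 11) :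
    TwoLegReadJetBound L M klC4aJetC2 (klC4aJetC' P R) β U μ (klFlowFrameU L M β U μ 0) 0 ∧
      TwoLegReadOscAt L M (klReadOscC P R) β U μ (klFlowFrameU L M β U μ 0) 0 := by
  obtain ⟨hJ, hO⟩ := twoLegRead_frameZero_private_of_records (L := L) (M := M) hβ hμ hU hUb hL hM hS12 hSjet hD
  obtain ⟨f1, f2, f3, f4⟩ := hfit
  obtain ⟨hC0, hOsc⟩ := two_pow_le_klC4aJetC'_zero P R
  refine ⟨hJ.mono (fun k => ?_) (fun k => ?_), hO.mono hOsc⟩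
  · rcases Nat.lt_or_ge k 5 with hk5 | hk5
    · interval_cases k
      · rw [if_pos rfl, klC4aJetC2_zero]; norm_num
      · rw [if_neg one_ne_zero, if_pos rfl, klC4aJetC2_one]; exact f1
      · rw [if_neg (by decide), if_neg (by decide), if_pos rfl, klC4aJetC2_two]; exact f2
      · rw [if_neg (by decide), if_neg (by decide), if_neg (by decide), if_pos rfl, klC4aJetC2_three]; exact f3
      · rw [if_neg (by decide), if_neg (by decide), if_neg (by decide), if_neg (by decide), if_pos rfl, klC4aJetC2_four]; exact f4
    · rw [if_neg (by omega), if_neg (by omega), if_neg (by omega), if_neg (by omega), if_neg (by omega)]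
      exact klC4aJetC2_nonneg k
  · rcases Nat.eq_zero_or_pos k with rfl | hk
    · rw [if_pos rfl]; exact hC0
    · rw [if_neg (by omega)]; exact klC4aJetC'_nonneg P R k

/-- **THE SCALE-0 MEMBER OF ROW (C) UNDER THE (C) CLOSER'S PREFIX, FROM ONE POINTWISE RECORD HYPOTHESIS** (`hrec`: at every `μ ∈ klWindowC`, `0 < U ≤ klTailBookU`,
`klBetaMin ≤ β`, `klEngL₃ β U ≤ L`, `klEngM₃ β U L ≤ M`, the #22a rows k = 1, 2, the #22b rows k = 3, 4, the free-curve sizes and the four fits): for EVERY `G`, `Q`,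
under `P.WF → R.WF2 → 0 < c → c ≤ klEngC₃7GU G P R → μ ∈ klWindowC → 0 < U → U ≤ klEngU₀12GQ G Q P R c → klBetaMin ≤ β → β ≤ exp(c/U²) → klEngL₄ P R β U ≤ L → klEngM₃ β U L ≤ M`:
`TwoLegReadJetBound L M klC4aJetC2 (klC4aJetC′ P R) β U μ (K₀) 0 ∧ TwoLegReadOscAt L M (klReadOscC P R) β U μ (K₀) 0` (`klEngU₀12GQ ≤ klTailBookU`, `klEngL₃ ≤ klEngL₄`).
This is the scale-`0` private pair of `hres′` (…ClosersCGQGuardInst) at `cc := klC4aJetC2`, `cc′ := klC4aJetC′ P R`, `x₀ := klReadOscC P R`: its residual is EXACTLY the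
record rows and the four fits. [cite: BenfattoGiulianiMastropietro2006, §2.4 Lemma 2.1 (2.36)-(2.42)] -/
theorem twoLegRead_frameZero_registered_klEngGQ_of_records (G : GeoConsts) (Q : EngConsts)
    (hrec : ∀ (μ U β : ℝ) (L M : ℕ) [NeZero L] [NeZero M], μ ∈ klWindowC → 0 < U → U ≤ klTailBookU → klBetaMin ≤ β →
      klEngL₃ β U ≤ L → klEngM₃ β U L ≤ M →
      ∃ bS sS D : ℕ → ℝ,
        (bS 1 * D 1 + (1 + D 1 + D 2 + D 3 + D 4) ^ 4 / (10 : ℝ) ^ 78 ≤ (2 : ℝ) ^ 10 ∧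
        bS 2 * D 1 ^ 2 + bS 1 * D 2 + (1 + D 1 + D 2 + D 3 + D 4) ^ 4 / (10 : ℝ) ^ 78 ≤ (2 : ℝ) ^ 4 ∧
        sS 3 + (1 + D 1 + D 2 + D 3 + D 4) ^ 4 / (10 : ℝ) ^ 78 ≤ (2 : ℝ) ^ 4 ∧ sS 4 + (1 + D 1 + D 2 + D 3 + D 4) ^ 4 / (10 : ℝ) ^ 78 ≤ (2 : ℝ) ^ 11) ∧
        (∀ θ : ℝ, ∀ i, 1 ≤ i → i ≤ 4 → ‖iteratedDeriv i (fun θ : ℝ => (WithLp.toLp 2 (klFermiPoint μ 0 θ) : Momentum)) θ‖ ≤ D i) ∧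
        (∀ k, 1 ≤ k → k ≤ 2 → ∀ (σ : Fin 2) (p₀ : GridPoint L (2 * (2 * M))), ∑ p₁ : GridPoint L (2 * (2 * M)),
          (if p₁ = p₀ then (0 : ℝ) else
            Real.sqrt ((((p₁.2 - p₀.2) 0).valMinAbs.natAbs : ℝ) ^ 2 + (((p₁.2 - p₀.2) 1).valMinAbs.natAbs : ℝ) ^ 2) ^ k * ‖contr ℂ ((hubbardGridSub L M β (2 * (2 * M))).transpose * hubbardCovAboveCT L M β μ 0 0 klE0 *
                    hubbardGridSub L M β (2 * (2 * M))) (((p₁, σ), 0) : GridLeg (GridPoint L (2 * (2 * M)))) ((p₀, σ), 1) *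
                  (contr ℂ ((hubbardGridSub L M β (2 * (2 * M))).transpose * hubbardCovAboveCT L M β μ 0 0 klE0 *
                    hubbardGridSub L M β (2 * (2 * M))) (((p₀, σ.rev), 0) : GridLeg (GridPoint L (2 * (2 * M)))) ((p₁, σ.rev), 1) *
                    contr ℂ ((hubbardGridSub L M β (2 * (2 * M))).transpose * hubbardCovAboveCT L M β μ 0 0 klE0 *
                    hubbardGridSub L M β (2 * (2 * M))) (((p₁, σ.rev), 0) : GridLeg (GridPoint L (2 * (2 * M)))) ((p₀, σ.rev), 1))‖) ≤
            bS k * (((2 * (2 * M) : ℕ) : ℝ) / β)) ∧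
        (∀ k, 3 ≤ k → k ≤ 4 → ∀ θ : ℝ, |iteratedDeriv k (fun θ : ℝ => evalM (symInterp L (fun pp : TorusSite 2 L =>
            (∑ σσ : Fin 2, ((selfEnergy L M β (ExteriorAlgebra.map (Matrix.toLin' (gridSubMatrix L M β
                (fun p : GridPoint L (2 * (2 * M)) => p.2) (fun p => gridTime β (2 * (2 * M)) p.1)))
              (∑ p' : GridPoint L (2 * (2 * M)), ∑ q' : GridPoint L (2 * (2 * M)), ∑ σ' : Fin 2,
              (if p' = q' then (0 : ℂ) else
                -((((U * (β / (2 * (2 * M) : ℕ)) : ℝ) : ℂ) ^ 2 *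
                  (contr ℂ ((hubbardGridSub L M β (2 * (2 * M))).transpose * hubbardCovAboveCT L M β μ 0 0 klE0 *
                      hubbardGridSub L M β (2 * (2 * M))) (((q', σ'), 0) : GridLeg (GridPoint L (2 * (2 * M)))) ((p', σ'), 1) *
                    (contr ℂ ((hubbardGridSub L M β (2 * (2 * M))).transpose * hubbardCovAboveCT L M β μ 0 0 klE0 *
                        hubbardGridSub L M β (2 * (2 * M))) (((p', σ'.rev), 0) : GridLeg (GridPoint L (2 * (2 * M)))) ((q', σ'.rev), 1) *
                      contr ℂ ((hubbardGridSub L M β (2 * (2 * M))).transpose * hubbardCovAboveCT L M β μ 0 0 klE0 *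
                        hubbardGridSub L M β (2 * (2 * M))) (((q', σ'.rev), 0) : GridLeg (GridPoint L (2 * (2 * M)))) ((p', σ'.rev), 1)))))) •
                (gen ℂ (((p', σ'), 0) : GridLeg (GridPoint L (2 * (2 * M)))) * gen ℂ (((q', σ'), 1) : GridLeg (GridPoint L (2 * (2 * M))))))) (omega0 M, pp) σσ).re +
            (selfEnergy L M β (ExteriorAlgebra.map (Matrix.toLin' (gridSubMatrix L M β
                (fun p : GridPoint L (2 * (2 * M)) => p.2) (fun p => gridTime β (2 * (2 * M)) p.1)))
              (∑ p' : GridPoint L (2 * (2 * M)), ∑ q' : GridPoint L (2 * (2 * M)), ∑ σ' : Fin 2,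
              (if p' = q' then (0 : ℂ) else
                -((((U * (β / (2 * (2 * M) : ℕ)) : ℝ) : ℂ) ^ 2 *
                  (contr ℂ ((hubbardGridSub L M β (2 * (2 * M))).transpose * hubbardCovAboveCT L M β μ 0 0 klE0 *
                      hubbardGridSub L M β (2 * (2 * M))) (((q', σ'), 0) : GridLeg (GridPoint L (2 * (2 * M)))) ((p', σ'), 1) *
                    (contr ℂ ((hubbardGridSub L M β (2 * (2 * M))).transpose * hubbardCovAboveCT L M β μ 0 0 klE0 *
                        hubbardGridSub L M β (2 * (2 * M))) (((p', σ'.rev), 0) : GridLeg (GridPoint L (2 * (2 * M)))) ((q', σ'.rev), 1) *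
                      contr ℂ ((hubbardGridSub L M β (2 * (2 * M))).transpose * hubbardCovAboveCT L M β μ 0 0 klE0 *
                        hubbardGridSub L M β (2 * (2 * M))) (((q', σ'.rev), 0) : GridLeg (GridPoint L (2 * (2 * M)))) ((p', σ'.rev), 1)))))) •
                (gen ℂ (((p', σ'), 0) : GridLeg (GridPoint L (2 * (2 * M)))) * gen ℂ (((q', σ'), 1) : GridLeg (GridPoint L (2 * (2 * M))))))) ((omega0 M).rev, pp) σσ).re)) / 4))
            (WithLp.toLp 2 (klFermiPoint μ 0 θ))) θ| ≤ sS k * U ^ 2)) :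
    ∀ (P : SplitConsts) (R : RenConsts) (c : ℝ), P.WF → R.WF2 → 0 < c → c ≤ klEngC₃7GU G P R →
      ∀ μ ∈ klWindowC, ∀ U : ℝ, 0 < U → U ≤ klEngU₀12GQ G Q P R c → ∀ β : ℝ, klBetaMin ≤ β → β ≤ Real.exp (c / U ^ 2) →
        ∀ (L M : ℕ) [NeZero L] [NeZero M], klEngL₄ P R β U ≤ L → klEngM₃ β U L ≤ M →
          TwoLegReadJetBound L M klC4aJetC2 (klC4aJetC' P R) β U μ (klFlowFrameU L M β U μ 0) 0 ∧
            TwoLegReadOscAt L M (klReadOscC P R) β U μ (klFlowFrameU L M β U μ 0) 0 := by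
  intro P R c _ _ _ _ μ hμ U hU hU12 β hβ _ L M _ _ hL hM
  have hUb : U ≤ klTailBookU := hU12.trans (klEngU₀12GQ_le_klTailBookU G Q P R c)
  have hL3 : klEngL₃ β U ≤ L := klEngL₃_le_of_klEngL₄_le hL
  obtain ⟨bS, sS, D, hfit, hD, hS12, hSjet⟩ := hrec μ U β L M hμ hU hUb hβ hL3 hM
  exact twoLegRead_frameZero_registered_of_records (L := L) (M := M) P R hβ hμ hU hUb hL3 hM hS12 hSjet hD hfit

end Registered

end Summit.HubbardSuperconductivity.HubbardSuperconductivity.Theorems.KLRegimeSplit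

end
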